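import Mathlib.Analysis.SpecialFunctions.Exponential
import Mathlib.Analysis.Normed.Ring.Units
import Mathlib.Analysis.Calculus.InverseFunctionTheorem.FDeriv
import Mathlib.Topology.UniformSpace.Matrix
import Literature.NumberTheory.Automorphic.AdelicGLnGlue
import HarnessLib

/-!
# Automorphic forms on `GL_n(𝔸_K)` are continuous

Topic `NumberTheory/Automorphic`. A function on `GL_n(𝔸_K)` which is smooth in the archimedean
variable (`IsArchSmooth` for the honest `GL_n` datum `AutomorphyDatum.gl n K hcpt` of
`AdelicGLnGlue`: `X ↦ φ (g · (exp X, 1))` is `C^∞` on `𝔤𝔩_n(K_∞)` for every `g`) and right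
invariant under an admissible level `U = {1} × U₀`, `U₀ ≤ GL_n(𝔸_K^∞)` compact open
(`finiteLevelsGL`), is continuous on `GL_n(𝔸_K)`; in particular every automorphic form is
(Borel–Jacquet 1979, 4.1–4.2: an automorphic form is a smooth function on `G(𝔸)`, i.e.
`f (x_∞ · x_f)` is smooth in `x_∞` and locally constant in `x_f`). The only analytic input is that
the matrix exponential is a local homeomorphism at `0` (inverse function theorem,
`HasStrictFDerivAt.map_nhds_eq_of_equiv` with `hasStrictFDerivAt_exp_zero`), transported to the
units topology of `GL_n` along the open embedding `Units.val` (`Units.isOpenEmbedding_val`):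

* `expGL_image_mem_nhds_one` — `exp(W)` is a neighbourhood of `1` in `GL N A` for every
  neighbourhood `W` of `0` in `Matrix N N A` (complete normed commutative `ℝ`-algebra `A`).
* `continuous_of_isArchSmooth_of_isRightInvariantUnder` — archimedean smoothness and right
  invariance under a level imply continuity on `GL_n(𝔸_K)`: near `g₀`,
  `φ (g) = φ (g₀ · (exp Y, 1))` with `Y` small, by the factorisation `h = (h_∞, 1)(1, h_f)`
  (`GLn.ofInfinite_toMixed_mul_ofFinite_sndHom`) and invariance under `(1, h_f) ∈ U`.
* `IsAutomorphicForm.continuous_gl` — automorphic forms on `GL_n(𝔸_K)` are continuous;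
  `continuous_of_isAutomorphicForm_invQuot` — so is `f` on the automorphic quotient when
  `invQuot f = (g ↦ f [g⁻¹])` is an automorphic form.

Step F4a of the decomposition of `AutomorphicRepsGL.exists_cuspidalRepData_of_L2`
(`AutomorphicRepsGLCuspidalL2`). Everything here is proved.

## References

* A. Borel, H. Jacquet, *Automorphic forms and automorphic representations*, Proc. Sympos. Pure
  Math. 33 (1979), part 1, §4.1–4.2 [BorelJacquet1979].
* A. W. Knapp, *Lie Groups Beyond an Introduction* (2002), 0.§2–§3 (`exp` near `0`).
-/

-- Mathlib idiom (Mathlib/Algebra/Lie/OfAssociative.lean); needed to mention Lie subalgebras of matrix algebras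
attribute [local instance 100] LieRing.ofAssociativeRing

noncomputable section

open scoped MatrixGroups Matrix ContDiff Classical
open NumberField NumberField.mixedEmbedding IsDedekindDomain Filter
open _root_.Topology

namespace Literature.NumberTheory.Automorphic

/-! ### The exponential is open at `0` into the units topology -/

section Exp

variable {A : Type*} [NormedCommRing A] [NormedAlgebra ℝ A] [NormedAlgebra ℚ A] [CompleteSpace A]
  {N : Type*} [Fintype N] [DecidableEq N]

-- As in `Mathlib/Analysis/Normed/Algebra/MatrixExponential.lean` and `RealMatrixGroupsProofs`: the
-- scoped `L∞`-operator normed ring structure on matrices is only reducibly-defeq to the Pi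
-- uniformity, so `CompleteSpace (Matrix N N A)` and the comparison of topologies need this setting.
set_option backward.isDefEq.respectTransparency false in
open scoped Matrix.Norms.Operator in
/-- **`exp` is open at `0` into `GL N A`.** For a neighbourhood `W` of `0` in `Matrix N N A`, the
set `{exp X | X ∈ W}` is a neighbourhood of `1` in `GL N A` (units topology): `exp` has strict
derivative `1` at `0`, so it maps the neighbourhood filter of `0` onto that of `1` in the matrix
algebra (inverse function theorem), and `Units.val : GL N A → Matrix N N A` is an open embedding.
Knapp, *Lie Groups Beyond an Introduction*, 0.§2–§3 (`exp` is a diffeomorphism near `0`). [folklore] -/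
theorem expGL_image_mem_nhds_one {W : Set (Matrix N N A)} (hW : W ∈ 𝓝 (0 : Matrix N N A)) :
    expGL '' W ∈ 𝓝 (1 : GL N A) := by
  -- `exp` maps `𝓝 0` onto `𝓝 1` in the Banach algebra `Matrix N N A`
  have hder : HasStrictFDerivAt (NormedSpace.exp : Matrix N N A → Matrix N N A)
      ((ContinuousLinearEquiv.refl ℝ (Matrix N N A) : Matrix N N A ≃L[ℝ] Matrix N N A) :
        Matrix N N A →L[ℝ] Matrix N N A) 0 :=
    (hasStrictFDerivAt_exp_zero (𝕂 := ℝ) (𝔸 := Matrix N N A)).congr_fderiv (by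
      ext X
      simp)
  have hmap : map NormedSpace.exp (𝓝 (0 : Matrix N N A)) = 𝓝 1 := by
    have h := hder.map_nhds_eq_of_equiv
    rwa [NormedSpace.exp_zero] at h
  have himg : NormedSpace.exp '' W ∈ 𝓝 (1 : Matrix N N A) := hmap ▸ image_mem_map hW
  -- transport along the open embedding `Units.val`
  rw [(Units.isOpenEmbedding_val (R := Matrix N N A)).nhds_eq_comap, Units.val_one]
  refine Filter.mem_comap.2 ⟨NormedSpace.exp '' W, himg, ?_⟩
  rintro u ⟨X, hX, hXu⟩
  refine ⟨X, hX, Units.ext ?_⟩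
  rw [coe_expGL, hXu]

end Exp

/-! ### Continuity on `GL_n(𝔸_K)` -/

section GLnContinuity

variable {n : ℕ} {K : Type} [Field K] [NumberField K]
  {hcpt : isCompact_glFiniteIntegralLevel n K}

/-- The projection `GL_n(𝔸_K) → GL_n(𝔸_K^∞)` is continuous (`GeneralLinearGroup.map` of the
continuous ring homomorphism `RingHom.snd`). [folklore] -/
theorem GLn.continuous_sndHom : Continuous (GLn.sndHom n K) :=
  continuous_snd.generalLinearGroup_map

/-- **Continuity from a continuous archimedean slice and level invariance.** Let
`φ : GL_n(𝔸_K) → ℂ` be right invariant under `{1} × U₀` with `U₀ ≤ GL_n(𝔸_K^∞)` open, and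
suppose the archimedean slice `Y ↦ φ (g₀ · (exp Y, 1))` through `g₀` is continuous at `Y = 0`.
Then `φ` is continuous at `g₀`: for `g` near `g₀`, `g₀⁻¹ g = (h_∞, 1) (1, h_f)` with `h_f ∈ U₀`
(`GLn.ofInfinite_toMixed_mul_ofFinite_sndHom`, continuity of the projection `GLn.sndHom`) and
`h_∞ = exp Y` with `Y` near `0` (`expGL_image_mem_nhds_one`, continuity of `GLn.toMixed`), so
`φ g = φ (g₀ (exp Y, 1))` is close to `φ g₀`. Borel–Jacquet 1979, §4.1 (`G(𝔸) = G_∞ × G(𝔸_f)`).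
[cite: BorelJacquet1979, §4.1–4.2] -/
theorem continuousAt_of_continuousAt_archSlice {φ : GL (Fin n) (AdeleRing (𝓞 K) K) → ℂ}
    {U₀ : Subgroup (GL (Fin n) (FiniteAdeleRing (𝓞 K) K))}
    (hU₀o : IsOpen (U₀ : Set (GL (Fin n) (FiniteAdeleRing (𝓞 K) K))))
    (hφU : IsRightInvariantUnder (U₀.map (GLn.ofFinite n K)) φ)
    (g₀ : GL (Fin n) (AdeleRing (𝓞 K) K))
    (hψ : ContinuousAt
      (fun Y : Matrix (Fin n) (Fin n) (mixedSpace K) => φ (g₀ * GLn.ofInfinite n K (expGL Y))) 0) :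
    ContinuousAt φ g₀ := by
  -- level invariance: `φ (g₀ h) = φ (g₀ (h_∞, 1))` whenever `h_f ∈ U₀`
  have hkey : ∀ h : GL (Fin n) (AdeleRing (𝓞 K) K), GLn.sndHom n K h ∈ U₀ →
      φ (g₀ * h) = φ (g₀ * GLn.ofInfinite n K (GLn.toMixed n K h)) := by
    intro h hh
    conv_lhs => rw [← GLn.ofInfinite_toMixed_mul_ofFinite_sndHom h, ← mul_assoc]
    exact hφU _ (Subgroup.mem_map.2 ⟨_, hh, rfl⟩) _
  have h0 : g₀ * GLn.ofInfinite n K (expGL 0) = g₀ := by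
    rw [expGL_zero, map_one, mul_one]
  -- the two neighbourhood conditions on `g₀⁻¹ g`
  have h1 : Tendsto (fun g : GL (Fin n) (AdeleRing (𝓞 K) K) => g₀⁻¹ * g) (𝓝 g₀) (𝓝 1) := by
    simpa only [inv_mul_cancel] using (continuous_const_mul g₀⁻¹).tendsto g₀
  have hsnd : Tendsto (fun g : GL (Fin n) (AdeleRing (𝓞 K) K) => GLn.sndHom n K (g₀⁻¹ * g))
      (𝓝 g₀) (𝓝 1) := by
    have h := ((GLn.continuous_sndHom (n := n) (K := K)).tendsto 1).comp h1
    rw [map_one] at h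
    exact h
  have htm : Tendsto (fun g : GL (Fin n) (AdeleRing (𝓞 K) K) => GLn.toMixed n K (g₀⁻¹ * g))
      (𝓝 g₀) (𝓝 1) := by
    have h := ((GLn.continuous_toMixed n K).tendsto 1).comp h1
    rw [map_one] at h
    exact h
  rw [ContinuousAt, Metric.tendsto_nhds]
  intro ε hε
  have hW : (fun Y : Matrix (Fin n) (Fin n) (mixedSpace K) => φ (g₀ * GLn.ofInfinite n K (expGL Y)))
      ⁻¹' Metric.ball (φ g₀) ε ∈ 𝓝 (0 : Matrix (Fin n) (Fin n) (mixedSpace K)) := by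
    refine hψ.preimage_mem_nhds (Metric.isOpen_ball.mem_nhds ?_)
    rw [h0]
    exact Metric.mem_ball_self hε
  have hA : ∀ᶠ g in 𝓝 g₀, GLn.sndHom n K (g₀⁻¹ * g) ∈ U₀ := hsnd (hU₀o.mem_nhds U₀.one_mem)
  have hB : ∀ᶠ g in 𝓝 g₀, GLn.toMixed n K (g₀⁻¹ * g) ∈ expGL ''
      ((fun Y : Matrix (Fin n) (Fin n) (mixedSpace K) => φ (g₀ * GLn.ofInfinite n K (expGL Y)))
        ⁻¹' Metric.ball (φ g₀) ε) :=
    htm (expGL_image_mem_nhds_one hW)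
  filter_upwards [hA, hB] with g hgA hgB
  obtain ⟨Y, hY, hYeq⟩ := hgB
  have hg : φ g = φ (g₀ * GLn.ofInfinite n K (expGL Y)) := by
    have : g = g₀ * (g₀⁻¹ * g) := by rw [mul_inv_cancel_left]
    rw [this, hkey _ hgA, ← hYeq]
  rw [hg]
  exact hY

-- the scoped operator norm on `𝔤𝔩_n(K_∞)` is the one through which `IsArchSmooth` is defined
open scoped Matrix.Norms.Operator in
/-- **The archimedean slices of an archimedean-smooth function are continuous**: if
`X ↦ φ (g · (exp X, 1))` is `C^∞` on `𝔤𝔩_n(K_∞)` for every `g` (`IsArchSmooth` for the `GL_n`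
datum), then `Y ↦ φ (g₀ (exp Y, 1))` is continuous on `M_n(K_∞)`. (The datum phrases smoothness
on the subtype `↥𝔤`, `𝔤 = ⊤`; we compose with the inclusion.) Borel–Jacquet 1979, §4.1–4.2.
[cite: BorelJacquet1979, §4.1–4.2] -/
theorem IsArchSmooth.continuous_archSlice {φ : GL (Fin n) (AdeleRing (𝓞 K) K) → ℂ}
    (hs : IsArchSmooth (AutomorphyDatum.gl n K hcpt).ofArch φ)
    (g₀ : GL (Fin n) (AdeleRing (𝓞 K) K)) :
    Continuous fun Y : Matrix (Fin n) (Fin n) (mixedSpace K) =>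
      φ (g₀ * GLn.ofInfinite n K (expGL Y)) := by
  have hmem : ∀ Y : Matrix (Fin n) (Fin n) (mixedSpace K),
      Y ∈ (archGroupGL n K).lie.toSubmodule := fun Y =>
    (LieSubalgebra.mem_toSubmodule _).2 (LieSubalgebra.mem_top Y)
  -- the slice, read through the datum: `ofArch (expMem X) = GLn.ofInfinite (expGL X)` (`rfl` lemmas)
  have hF := (hs g₀).continuous
  simp only [AutomorphyDatum.gl_ofArch_apply, RealMatrixGroup.coe_expMem] at hF
  have hmk : Continuous fun Y : Matrix (Fin n) (Fin n) (mixedSpace K) =>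
      (⟨Y, hmem Y⟩ : (archGroupGL n K).lie.toSubmodule) :=
    continuous_id.subtype_mk fun Y => hmem Y
  have h := hF.comp hmk
  exact h

/-- **Archimedean smoothness and level invariance imply continuity.** A function
`φ : GL_n(𝔸_K) → ℂ` which is smooth in the archimedean variable for the `GL_n` datum and right
invariant under an admissible level `U = {1} × U₀` (`U₀ ≤ GL_n(𝔸_K^∞)` compact open) is
continuous (`continuousAt_of_continuousAt_archSlice` with `IsArchSmooth.continuous_archSlice`).
Borel–Jacquet 1979, §4.1–4.2. [cite: BorelJacquet1979, §4.1–4.2] -/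
theorem continuous_of_isArchSmooth_of_isRightInvariantUnder
    {φ : GL (Fin n) (AdeleRing (𝓞 K) K) → ℂ}
    (hs : IsArchSmooth (AutomorphyDatum.gl n K hcpt).ofArch φ)
    {U : Subgroup (GL (Fin n) (AdeleRing (𝓞 K) K))} (hU : U ∈ finiteLevelsGL n K)
    (hφU : IsRightInvariantUnder U φ) : Continuous φ := by
  obtain ⟨U₀, hU₀o, -, rfl⟩ := hU
  exact continuous_iff_continuousAt.2 fun g₀ =>
    continuousAt_of_continuousAt_archSlice hU₀o hφU g₀ (hs.continuous_archSlice g₀).continuousAt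

/-- **Automorphic forms on `GL_n(𝔸_K)` are continuous** (smooth in the archimedean variable and
right invariant under a compact open subgroup of `GL_n(𝔸_K^∞)`). Borel–Jacquet 1979, §4.1–4.2. [cite: BorelJacquet1979, §4.1–4.2] -/
theorem IsAutomorphicForm.continuous_gl {φ : (AdelicGroupData.gl n K).Adelic → ℂ}
    (hφ : IsAutomorphicForm (AutomorphyDatum.gl n K hcpt) φ) : Continuous φ := by
  obtain ⟨U, hU, hφU⟩ := hφ.exists_level
  exact continuous_of_isArchSmooth_of_isRightInvariantUnder hφ.archSmooth hU hφU

/-- A function on the automorphic quotient whose inversion `invQuot f = (g ↦ f [g⁻¹])` is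
continuous on `GL_n(𝔸_K)` is continuous (the projection to the quotient is a quotient map and
inversion is continuous). [folklore] -/
theorem continuous_of_continuous_invQuot {f : (AdelicGroupData.gl n K).automorphicQuotient → ℂ}
    (hf : Continuous (invQuot (AdelicGroupData.gl n K) f)) : Continuous f := by
  have hq : IsQuotientMap ((AdelicGroupData.gl n K).toAutomorphicQuotient) :=
    QuotientGroup.isQuotientMap_mk _
  refine hq.continuous_iff.2 ?_
  have : f ∘ (AdelicGroupData.gl n K).toAutomorphicQuotient =
      fun g => invQuot (AdelicGroupData.gl n K) f g⁻¹ := by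
    funext g
    simp only [Function.comp_apply, invQuot_apply, inv_inv]
  rw [this]
  exact hf.comp continuous_inv

/-- For an automorphic form `invQuot f` on `GL_n(𝔸_K)`, the function `f` on the automorphic
quotient is continuous. Borel–Jacquet 1979, §4.1–4.2. [cite: BorelJacquet1979, §4.1–4.2] -/
theorem continuous_of_isAutomorphicForm_invQuot
    {f : (AdelicGroupData.gl n K).automorphicQuotient → ℂ}
    (hf : IsAutomorphicForm (AutomorphyDatum.gl n K hcpt) (invQuot (AdelicGroupData.gl n K) f)) :
    Continuous f :=
  continuous_of_continuous_invQuot hf.continuous_gl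

end GLnContinuity

end Literature.NumberTheory.Automorphic
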